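import Summits.CriticalPhenomena.CardyFormulaZ2.Theorems.CardyMagicRigidityNestingRigidityNeckZ2StrandsWitnesses
import Literature.Probability.Percolation.ZdCrossingTranspose
import HarnessLib

/-!
# Crux `NestingRigidity`, line `pinch-resampling` (v4), stub S12: `ZFourStrandsPositive` (II) — the two barrier lemmas

Crux `Summit.CriticalPhenomena.CardyFormulaZ2.Theses.CardyMagicRigidity.NestingRigidity` (stmt-CriticalPhenomena-4835),
line `pinch-resampling` v4, stub S12, input `ZFourStrandsPositive`; sequel of `…NeckZ2StrandsWitnesses` (strategy there).

This file: §4b the bottom dual witness in normal form; §5 the two PRIMAL feet are not joined inside the collar (registered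
anchor `strands_primal_feet_not_joined`: the top and bottom witnesses, closed by their steps into the hole, are the two
dual arms of the tree's barrier lemma `not_openConnIn_sqAnnulus_of_dualArmsTB`); §6 the barrier lemma transposed (east
and west arms against a top-to-bottom path); §7 the two DUAL feet are not joined inside the dual collar: a joining face
path, together with the east and west witnesses shifted by `-(1,1)` to the lattice of faces (where the separating edge
of the two shifted endpoints of an edge is its dual edge, `sepEdge_add_neg_one`), is excluded by §6.
-/

noncomputable section

namespace Summit.CriticalPhenomena.CardyFormulaZ2.Cruxes.NestingRigidity.PinchResampling

open MeasureTheory Set Literature.Probability.Percolation Literature.Probability.LatticeModels SimpleGraph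
open ZPinchLocality NeckCoarseZ2

namespace ZStrands

variable {ω : BondConfig (Site 2)} {s : ℕ}

/-! ## §4b The bottom dual witness -/

/-- **Bottom dual witness** (mirror image of `exists_top`): from a ring face `a` (row `-(2s+1)`) up to a face `f` of the
row `-(s+2)`, all faces in the rows `[-(2s+1), -(s+2)]`, followed by the closed step into the hole face `f + e₁`. -/
theorem exists_bot (hs : 1 ≤ s) (h : ω ∈ dualFaceCrossing ![0, -(2 * (s : ℤ))] (wq s) (s - 1)) :
    ∃ (a f : Site 2) (U : (zdGraph 2).Walk a f), a 1 = -(2 * (s : ℤ) + 1) ∧ f 1 = -((s : ℤ) + 2) ∧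
      (∀ g ∈ U.support, (0 ≤ g 0 ∧ g 0 + 1 ≤ wq s) ∧ (-(2 * (s : ℤ) + 1) ≤ g 1 ∧ g 1 ≤ -((s : ℤ) + 2))) ∧
      (∀ d ∈ U.darts, sepEdge d.fst d.snd ∉ ω) ∧ sepEdge f (f + Pi.single 1 1) ∉ ω := by
  obtain ⟨a, b, W, ha, hb, hWs, hWc⟩ := h
  simp only [Matrix.cons_val_zero, Matrix.cons_val_one] at ha hb hWs
  have hWc' := forall_darts_reverse_sepEdge_notMem W hWc
  obtain ⟨x, z, q₁, hxz, hz, hq₁A, hq₁s, hq₁e, hlast⟩ :=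
    exists_prefix_exit (A := {v : Site 2 | v 1 ≤ -((s : ℤ) + 2)}) W.reverse (show b 1 ≤ -((s : ℤ) + 2) by omega)
      (show ¬ (a 1 ≤ -((s : ℤ) + 2)) by omega)
  have hzW' := W.reverse.snd_mem_support_of_mem_edges hlast
  rw [Walk.support_reverse, List.mem_reverse] at hzW'
  have hzW := hWs z hzW'
  have hxW : x ∈ W.support := by
    have := hq₁s x q₁.end_mem_support; rwa [Walk.support_reverse, List.mem_reverse] at this
  have hx := hWs x hxW
  have hxA : x 1 ≤ -((s : ℤ) + 2) := hq₁A x q₁.end_mem_support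
  have hz' : ¬ z 1 ≤ -((s : ℤ) + 2) := hz
  have hzeq : z = x + Pi.single 1 1 := by
    rw [Site.eq_iff_two]
    rcases stepKind_of_adj hxz with ⟨h0, h1⟩ | ⟨h0, h1⟩ | ⟨h1, h0⟩ | ⟨h1, h0⟩ <;>
      simp only [Pi.add_apply, single_one_apply_zero, single_one_apply_one] <;> omega
  refine ⟨b, x, q₁, by omega, ?_, fun g hg ↦ ?_, forall_darts_sepEdge_notMem_of_edges W.reverse hWc' q₁ hq₁e, ?_⟩
  · rcases stepKind_of_adj hxz with ⟨h0, h1⟩ | ⟨h0, h1⟩ | ⟨h1, h0⟩ | ⟨h1, h0⟩ <;> omega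
  · have hg' : g ∈ W.support := by
      have := hq₁s g hg; rwa [Walk.support_reverse, List.mem_reverse] at this
    have h1 := hWs g hg'
    have h2 : g 1 ≤ -((s : ℤ) + 2) := hq₁A g hg
    omega
  · rw [← hzeq]; exact sepEdge_notMem_of_mem_edges W.reverse hWc' hlast

/-! ## §5 The primal feet are not joined inside the collar -/

/-- **The two primal feet are not joined by an open path of the collar** (registered helper, anchor of this module
on the crux item): the top and bottom dual witnesses, closed by their steps into the hole, are the two dual arms of the
tree's barrier lemma `not_openConnIn_sqAnnulus_of_dualArmsTB`. -/
theorem strands_primal_feet_not_joined : ∀ (ω : BondConfig (Site 2)) (s : ℕ), 8 ≤ s → ω ⊆ (zdGraph 2).edgeSet → ∀ (e w : Site 2), e 0 = s + 1 → (0 ≤ e 1 ∧ e 1 ≤ hq s) → w 0 = -((s : ℤ) + 1) → (0 ≤ w 1 ∧ w 1 ≤ hq s) → ∀ (a₁ f₁ : Site 2) (U₁ : (zdGraph 2).Walk a₁ f₁), a₁ 1 = 2 * s → f₁ 1 = s + 1 → (∀ g ∈ U₁.support, (0 ≤ g 0 ∧ g 0 + 1 ≤ wq s) ∧ ((s : ℤ)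 + 1 ≤ g 1 ∧ g 1 ≤ 2 * s)) → (∀ d ∈ U₁.darts, sepEdge d.fst d.snd ∉ ω) → sepEdge f₁ (f₁ - Pi.single 1 1) ∉ ω → ∀ (a₂ f₂ : Site 2) (U₂ : (zdGraph 2).Walk a₂ f₂), a₂ 1 = -(2 * (s : ℤ) + 1) → f₂ 1 = -((s : ℤ) + 2) → (∀ g ∈ U₂.support, (0 ≤ g 0 ∧ g 0 + 1 ≤ wq s) ∧ (-(2 * (s : ℤ) + 1) ≤ g 1 ∧ g 1 ≤ -((s : ℤ) + 2))) → (∀ d ∈ U₂.darts, sepEdge d.fst d.snd ∉ ω) → sepEdge f₂ (f₂ + Pi.single 1 1) ∉ ω → ¬ PathIn (openGraph ω) (zBall 0 (2 * s) \ zBall 0 s) e w := by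
  intro ω s hs hω e w he0 he1 hw0 hw1 a₁ f₁ U₁ ha₁ hf₁ hU₁ hU₁c hf₁c a₂ f₂ U₂ ha₂ hf₂ hU₂ hU₂c hf₂c hP
  have hhq : (hq s : ℤ) ≤ s := by unfold hq; omega
  have hwq : (wq s : ℤ) + 1 ≤ s := by unfold wq; omega
  have hconn : ω ∈ openConnIn (sqAnnulus (s + 1) (2 * s)) e w := by
    rw [← collar_eq_sqAnnulus]; exact DCT16.mem_openConnIn_iff_pathIn.2 hP
  -- top dual arm: from the hole face `f₁ - e₁` up to the ring face `a₁`
  have hδ₁ : ∀ dq ∈ ((U₁.concat (adj_sub_single_one f₁)).reverse).darts, sepEdge dq.fst dq.snd ∉ ω ∧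
      ∀ v ∈ sepEdge dq.fst dq.snd, v ∉ box 2 (s + 1 - 1) := by
    refine faceWalk_reverse _ fun d hd ↦ ?_
    rw [Walk.darts_concat, List.concat_eq_append, List.mem_append, List.mem_singleton] at hd
    rcases hd with hd | rfl
    · refine ⟨hU₁c d hd, fun v hv ↦ notMem_box_of_lt_apply 1 ?_⟩
      have h1 := (hU₁ _ (U₁.dart_fst_mem_support_of_mem_darts hd)).2.1
      have h2 := (sepEdge_apply_le hv).2.1
      have h3 : d.fst 1 ≤ max (d.fst 1) (d.snd 1) := le_max_left _ _
      omega
    · change sepEdge f₁ (f₁ - Pi.single 1 1) ∉ ω ∧ ∀ v ∈ sepEdge f₁ (f₁ - Pi.single 1 1), v ∉ box 2 (s + 1 - 1)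
      refine ⟨hf₁c, fun v hv ↦ notMem_box_of_lt_apply 1 ?_⟩
      have h2 := (sepEdge_apply_le hv).2.1
      have h3 : f₁ 1 ≤ max (f₁ 1) ((f₁ - Pi.single 1 1 : Site 2) 1) := le_max_left _ _
      omega
  -- bottom dual arm: from the hole face `f₂ + e₁` down to the ring face `a₂`
  have hδ₂ : ∀ dq ∈ ((U₂.concat ((zdGraph_adj_iff _ _).2 ⟨1, Or.inl rfl⟩ : (zdGraph 2).Adj f₂ (f₂ + Pi.single 1 1))).reverse).darts, sepEdge dq.fst dq.snd ∉ ω ∧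
      ∀ v ∈ sepEdge dq.fst dq.snd, v ∉ box 2 (s + 1 - 1) := by
    refine faceWalk_reverse _ fun d hd ↦ ?_
    rw [Walk.darts_concat, List.concat_eq_append, List.mem_append, List.mem_singleton] at hd
    rcases hd with hd | rfl
    · refine ⟨hU₂c d hd, fun v hv ↦ notMem_box_of_apply_lt 1 ?_⟩
      have h1 := (hU₂ _ (U₂.dart_fst_mem_support_of_mem_darts hd)).2.2
      have h1' := (hU₂ _ (U₂.dart_snd_mem_support_of_mem_darts hd)).2.2
      have h2 := (sepEdge_apply_le hv).2.2
      have h3 : max (d.fst 1) (d.snd 1) ≤ -((s : ℤ) + 2) := max_le h1 h1'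
      omega
    · change sepEdge f₂ (f₂ + Pi.single 1 1) ∉ ω ∧ ∀ v ∈ sepEdge f₂ (f₂ + Pi.single 1 1), v ∉ box 2 (s + 1 - 1)
      refine ⟨hf₂c, fun v hv ↦ notMem_box_of_apply_lt 1 ?_⟩
      rw [sepEdge_up, Sym2.mem_iff] at hv
      rcases hv with rfl | rfl <;> simp only [Pi.add_apply, single_one_apply_one, single_zero_apply_one] <;> omega
  have hf₁0 := (hU₁ f₁ U₁.end_mem_support).1
  have hf₂0 := (hU₂ f₂ U₂.end_mem_support).1
  refine not_openConnIn_sqAnnulus_of_dualArmsTB (m := s + 1) (n := 2 * s) (by omega) (by omega) hω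
    (e := e) (w := w) (by push_cast; exact he0) (by rw [abs_le]; push_cast; omega) (by push_cast; omega)
    (by rw [abs_le]; push_cast; omega)
    _ ⟨?_, ?_, ?_⟩ (by push_cast; omega) hδ₁ _ ⟨?_, ?_, ?_⟩ (by push_cast; omega) hδ₂ hconn
  · simp only [Pi.sub_apply, single_one_apply_zero, sub_zero]; push_cast; omega
  · simp only [Pi.sub_apply, single_one_apply_zero, sub_zero]; push_cast; omega
  · simp only [Pi.sub_apply, single_one_apply_one]; push_cast; omega
  · simp only [Pi.add_apply, single_one_apply_zero, add_zero]; push_cast; omega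
  · simp only [Pi.add_apply, single_one_apply_zero, add_zero]; push_cast; omega
  · simp only [Pi.add_apply, single_one_apply_one]; push_cast; omega

/-! ## §6 The barrier lemma transposed: east and west arms against a top-to-bottom path -/

/-- Transposition preserves the square annulus. -/
theorem transposeIso_mem_sqAnnulus {m n : ℕ} (hm : 1 ≤ m) {z : Site 2} (hz : z ∈ sqAnnulus m n) :
    transposeIso z ∈ sqAnnulus m n := by
  rw [mem_sqAnnulus_iff hm, Fin.forall_fin_two, Fin.exists_fin_two] at hz ⊢
  simp only [transposeIso_apply_zero, transposeIso_apply_one]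
  exact ⟨⟨hz.1.2, hz.1.1⟩, hz.2.symm⟩

/-- Transposition preserves boxes. -/
theorem transposeIso_mem_box_iff {k : ℕ} {v : Site 2} : transposeIso v ∈ box 2 k ↔ v ∈ box 2 k := by
  simp only [mem_box, Fin.forall_fin_two, transposeIso_apply_zero, transposeIso_apply_one]
  tauto

/-- Transport of the dart condition of the barrier lemma along transposition. -/
theorem dartCond_map_transposeIso {k : ℕ} {E : List (Sym2 (Site 2))} {c d : Site 2} (α : (zdGraph 2).Walk c d)
    (hα : ∀ dq ∈ α.darts, sepEdge dq.fst dq.snd ∉ E ∧ ∀ v ∈ sepEdge dq.fst dq.snd, v ∉ box 2 k) :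
    ∀ dq ∈ (α.map transposeIso.toHom).darts, sepEdge dq.fst dq.snd ∉ E.map (Sym2.map transposeIso) ∧
      ∀ v ∈ sepEdge dq.fst dq.snd, v ∉ box 2 k := by
  intro dq hdq
  rw [Walk.darts_map, List.mem_map] at hdq
  obtain ⟨d, hd, rfl⟩ := hdq
  change sepEdge (transposeIso d.fst) (transposeIso d.snd) ∉ _ ∧
    ∀ v ∈ sepEdge (transposeIso d.fst) (transposeIso d.snd), v ∉ box 2 k
  rw [sepEdge_transposeIso d.adj]
  refine ⟨fun hmem ↦ (hα d hd).1 ?_, fun v hv ↦ ?_⟩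
  · obtain ⟨e', he', hee⟩ := List.mem_map.1 hmem
    rwa [← Sym2.map.injective transposeIso.injective hee]
  · obtain ⟨u, hu, rfl⟩ := Sym2.mem_map.1 hv
    exact fun hb ↦ (hα d hd).2 u hu (transposeIso_mem_box_iff.1 hb)

/-- **The barrier lemma of `SqAnnulusDualBarrier.lean`, transposed.**  A lattice walk `P` inside `A_{m,n}` from the
inner top side to the inner bottom side cannot coexist with a walk of faces from the face column `m - 1` (just inside
the inner east side, at a height in `[-m+1, m-2]`) to the column `n` and a walk of faces from the face column `-m`
to the column `-n-1`, both crossing only edges that are not edges of `P` and lie off the hole `B(m-1)`. -/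
theorem sqAnnulus_arms_false_transpose {m n : ℕ} (hm : 2 ≤ m) (hmn : m ≤ n)
    {e w : Site 2} (P : (zdGraph 2).Walk e w) (hP : ∀ z ∈ P.support, z ∈ sqAnnulus m n)
    (he1 : e 1 = m) (he0 : |e 0| ≤ (m : ℤ) - 1) (hw1 : w 1 = -(m : ℤ)) (hw0 : |w 0| ≤ (m : ℤ) - 1)
    {c₁ d₁ : Site 2} (α₁ : (zdGraph 2).Walk c₁ d₁)
    (hc₁ : -(m : ℤ) + 1 ≤ c₁ 1 ∧ c₁ 1 ≤ (m : ℤ) - 2 ∧ c₁ 0 = (m : ℤ) - 1) (hd₁ : (n : ℤ) ≤ d₁ 0)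
    (hα₁ : ∀ dq ∈ α₁.darts, sepEdge dq.fst dq.snd ∉ P.edges ∧ ∀ v ∈ sepEdge dq.fst dq.snd, v ∉ box 2 (m - 1))
    {c₂ d₂ : Site 2} (α₂ : (zdGraph 2).Walk c₂ d₂)
    (hc₂ : -(m : ℤ) + 1 ≤ c₂ 1 ∧ c₂ 1 ≤ (m : ℤ) - 2 ∧ c₂ 0 = -(m : ℤ)) (hd₂ : d₂ 0 + 1 ≤ -(n : ℤ))
    (hα₂ : ∀ dq ∈ α₂.darts, sepEdge dq.fst dq.snd ∉ P.edges ∧ ∀ v ∈ sepEdge dq.fst dq.snd, v ∉ box 2 (m - 1)) :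
    False := by
  have hPe : (P.map transposeIso.toHom).edges = P.edges.map (Sym2.map transposeIso) := Walk.edges_map _ _
  refine sqAnnulus_dualArmsTB_false hm hmn (P.map transposeIso.toHom) (fun z hz ↦ ?_)
    (by simpa using he1) (by simpa using he0) (by simpa using hw1) (by simpa using hw0)
    (α₁.map transposeIso.toHom) (by simpa using hc₁) (by simpa using hd₁) ?_
    (α₂.map transposeIso.toHom) (by simpa using hc₂) (by simpa using hd₂) ?_
  · rw [Walk.support_map, List.mem_map] at hz
    obtain ⟨z₀, hz₀, rfl⟩ := hz
    exact transposeIso_mem_sqAnnulus (by omega) (hP z₀ hz₀)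
  · rw [hPe]; exact dartCond_map_transposeIso α₁ hα₁
  · rw [hPe]; exact dartCond_map_transposeIso α₂ hα₂

/-! ## §7 The two dual feet are not joined inside the dual collar -/

/-- `(1 : ℤ²)` is `e₀ + e₁`, coordinatewise. -/
theorem one_apply_site (i : Fin 2) : (1 : Site 2) i = 1 := rfl

/-- **The face walk of an edge of `ℤ²`, read on the lattice of faces**: shifting both endpoints of a lattice edge by
`-(1,1)` gives two adjacent FACES whose separating edge is the dual edge of the original edge (double duality with the
lower-left-corner indexing, cf. `dualEdge_dualEdge`). -/
theorem sepEdge_add_neg_one {u u' : Site 2} (h : (zdGraph 2).Adj u u') :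
    sepEdge (u + (-1)) (u' + (-1)) = dualEdge s(u, u') := by
  rcases stepKind_of_adj h with ⟨h0, h1⟩ | ⟨h0, h1⟩ | ⟨h1, h0⟩ | ⟨h1, h0⟩
  · obtain rfl : u' = u + Pi.single 0 1 := by simp [Site.eq_iff_two, h0, h1]
    have e1 : u + Pi.single 0 1 + (-1) = u + (-1) + Pi.single 0 1 := by abel
    have e2 : u + (-1) + Pi.single 0 1 = u - Pi.single 1 1 := by
      simp [Site.eq_iff_two]; omega
    rw [e1, sepEdge_right, dualEdge_horizontal, e2, sub_add_cancel]
  · obtain rfl : u = u' + Pi.single 0 1 := by simp [Site.eq_iff_two, h0, h1]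
    have e1 : u' + Pi.single 0 1 + (-1) = u' + (-1) + Pi.single 0 1 := by abel
    have e2 : u' + (-1) + Pi.single 0 1 = u' - Pi.single 1 1 := by
      simp [Site.eq_iff_two]; omega
    rw [Sym2.eq_swap, sepEdge_comm, e1, sepEdge_right, dualEdge_horizontal, e2, sub_add_cancel]
  · obtain rfl : u' = u + Pi.single 1 1 := by simp [Site.eq_iff_two, h0, h1]
    have e1 : u + Pi.single 1 1 + (-1) = u + (-1) + Pi.single 1 1 := by abel
    have e2 : u + (-1) + Pi.single 1 1 = u - Pi.single 0 1 := by
      simp [Site.eq_iff_two]; omega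
    rw [e1, sepEdge_up, dualEdge_vertical, e2, sub_add_cancel]
  · obtain rfl : u = u' + Pi.single 1 1 := by simp [Site.eq_iff_two, h0, h1]
    have e1 : u' + Pi.single 1 1 + (-1) = u' + (-1) + Pi.single 1 1 := by abel
    have e2 : u' + (-1) + Pi.single 1 1 = u' - Pi.single 0 1 := by
      simp [Site.eq_iff_two]; omega
    rw [Sym2.eq_swap, sepEdge_comm, e1, sepEdge_up, dualEdge_vertical, e2, sub_add_cancel]

/-- Coordinates of the endpoints of the dual edge of a lattice edge `{u, u'}`: within `[min - 1, min]`, and equal to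
the common value in the direction of the edge. -/
theorem mem_dualEdge_bounds {u u' v : Site 2} (h : (zdGraph 2).Adj u u') (hv : v ∈ dualEdge s(u, u')) :
    (min (u 0) (u' 0) - 1 ≤ v 0 ∧ v 0 ≤ min (u 0) (u' 0) ∧ (u 1 = u' 1 → min (u 0) (u' 0) ≤ v 0)) ∧
      (min (u 1) (u' 1) - 1 ≤ v 1 ∧ v 1 ≤ min (u 1) (u' 1) ∧ (u 0 = u' 0 → min (u 1) (u' 1) ≤ v 1)) := by
  rcases stepKind_of_adj h with ⟨h0, h1⟩ | ⟨h0, h1⟩ | ⟨h1, h0⟩ | ⟨h1, h0⟩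
  · obtain rfl : u' = u + Pi.single 0 1 := by simp [Site.eq_iff_two, h0, h1]
    rw [dualEdge_horizontal, Sym2.mem_iff] at hv
    rcases hv with rfl | rfl <;> simp
  · obtain rfl : u = u' + Pi.single 0 1 := by simp [Site.eq_iff_two, h0, h1]
    rw [Sym2.eq_swap, dualEdge_horizontal, Sym2.mem_iff] at hv
    rcases hv with rfl | rfl <;> simp
  · obtain rfl : u' = u + Pi.single 1 1 := by simp [Site.eq_iff_two, h0, h1]
    rw [dualEdge_vertical, Sym2.mem_iff] at hv
    rcases hv with rfl | rfl <;> simp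
  · obtain rfl : u = u' + Pi.single 1 1 := by simp [Site.eq_iff_two, h0, h1]
    rw [Sym2.eq_swap, dualEdge_vertical, Sym2.mem_iff] at hv
    rcases hv with rfl | rfl <;> simp

/-- An open edge is not crossed by a face walk crossing closed edges only: its dual edge is not a step of the walk. -/
theorem dualEdge_notMem_edges_of_open {a b u u' : Site 2} (P₀ : (zdGraph 2).Walk a b)
    (hP₀ : ∀ d ∈ P₀.darts, sepEdge d.fst d.snd ∉ ω) (hu : s(u, u') ∈ ω) : dualEdge s(u, u') ∉ P₀.edges := by
  intro hmem
  obtain ⟨d, hd, hde⟩ := (mem_edges_iff_darts P₀).1 hmem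
  have h1 : dualEdge (sepEdge d.fst d.snd) = dualEdge s(u, u') := by rw [dualEdge_sepEdge d.adj, ← hde]; rfl
  exact hP₀ d hd (by rwa [dualEdge_bijective.injective h1])

/-- A pair with a member off the carrier of a walk is not an edge of the walk. -/
theorem notMem_edges_of_notMem_support {V : Type*} {G : SimpleGraph V} {a b : V} (P : G.Walk a b)
    {ε : Sym2 V} {v : V} (hv : v ∈ ε) (hvP : v ∉ P.support) : ε ∉ P.edges := fun h ↦
  hvP (P.mem_support_of_mem_edges h hv)

/-- **The two dual feet are not joined by a dual-open path of the dual collar.**  A joining face path, closed by the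
step into the hole face below the bottom foot, together with the east witness (plus one further sticking-out edge)
and the west witness (plus the hole edge in front of it), both shifted by `-(1,1)` to the lattice of faces, is the
configuration excluded by the transposed barrier lemma `sqAnnulus_arms_false_transpose` for `A_{s+1, 2s+1}` read on
the face lattice. -/
theorem strands_dual_feet_not_joined (hs : 8 ≤ s)
    {e p : Site 2} (R : (zdGraph 2).Walk e p) (he0 : e 0 = s + 1) (hp0 : p 0 = 2 * s)
    (hR : ∀ z ∈ R.support, ((s : ℤ) + 1 ≤ z 0 ∧ z 0 ≤ 2 * s) ∧ (0 ≤ z 1 ∧ z 1 ≤ hq s))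
    (hRd : ∀ d ∈ R.darts, (s : ℤ) + 2 ≤ d.snd 0) (hRo : ∀ ed ∈ R.edges, ed ∈ ω)
    (hpe : s(p, p + Pi.single 0 1) ∈ ω)
    {w p' : Site 2} (R' : (zdGraph 2).Walk w p') (hw0 : w 0 = -((s : ℤ) + 1)) (hp'0 : p' 0 = -(2 * (s : ℤ)))
    (hR' : ∀ z ∈ R'.support, (-(2 * (s : ℤ)) ≤ z 0 ∧ z 0 ≤ -((s : ℤ) + 1)) ∧ (0 ≤ z 1 ∧ z 1 ≤ hq s))
    (hR'o : ∀ ed ∈ R'.edges, ed ∈ ω) (hp'e : s(p', p' - Pi.single 0 1) ∈ ω)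
    {f₁ f₂ : Site 2} (hf₁ : f₁ 1 = s + 1) (hf₁0 : 0 ≤ f₁ 0 ∧ f₁ 0 + 1 ≤ wq s)
    (hf₂ : f₂ 1 = -((s : ℤ) + 2)) (hf₂0 : 0 ≤ f₂ 0 ∧ f₂ 0 + 1 ≤ wq s) :
    ¬ PathIn (openGraph (dualConfig ω)) (zDualBall 0 (2 * s) \ zDualBall 0 s) f₁ f₂ := by
  intro hP
  have hhq : (hq s : ℤ) ≤ s := by unfold hq; omega
  have hwq : (wq s : ℤ) + 1 ≤ s := by unfold wq; omega
  obtain ⟨P₀, hP₀s, hP₀c⟩ := exists_faceWalk_of_pathIn hP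
  -- the top-to-bottom path of faces, closed into the hole face `f₂ + e₁`
  set P := P₀.concat ((zdGraph_adj_iff _ _).2 ⟨1, Or.inl rfl⟩ : (zdGraph 2).Adj f₂ (f₂ + Pi.single 1 1)) with hPdef
  have hPs : ∀ z ∈ P.support, z ∈ sqAnnulus (s + 1) (2 * s + 1) := by
    intro z hz
    rw [hPdef, Walk.support_concat, List.mem_append, List.mem_singleton] at hz
    rw [mem_sqAnnulus_iff (by omega), Fin.forall_fin_two, Fin.exists_fin_two]
    rcases hz with hz | rfl
    · have := mem_dualCollar_iff.1 (hP₀s z hz); push_cast; omega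
    · simp only [Pi.add_apply, single_one_apply_zero, single_one_apply_one, add_zero]; push_cast; omega
  have hPedges : P.edges = P₀.edges ++ [s(f₂, f₂ + Pi.single 1 1)] := by
    rw [hPdef, Walk.edges_concat, List.concat_eq_append]
  -- a candidate crossed edge is not an edge of `P` once it is off `P₀` and has both members at height `≥ -1`
  have hnotP : ∀ ε : Sym2 (Site 2), ε ∉ P₀.edges → (∀ v ∈ ε, -1 ≤ v 1) → ε ∉ P.edges := by
    intro ε h1 h2 hε
    rw [hPedges, List.mem_append, List.mem_singleton] at hε
    rcases hε with hε | rfl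
    · exact h1 hε
    · have := h2 f₂ (Sym2.mem_mk_left _ _); omega
  -- EAST arm: `R`, the sticking-out edge, one more edge, shifted by `-(1,1)`
  have h₁ : (zdGraph 2).Adj p (p + Pi.single 0 1) := (zdGraph_adj_iff _ _).2 ⟨0, Or.inl rfl⟩
  have h₂ : (zdGraph 2).Adj (p + Pi.single 0 1) (p + Pi.single 0 1 + Pi.single 0 1) :=
    (zdGraph_adj_iff _ _).2 ⟨0, Or.inl rfl⟩
  set Q₁ := (R.concat h₁).concat h₂ with hQ₁
  have hQ₁d : ∀ d ∈ Q₁.darts, dualEdge s(d.fst, d.snd) ∉ P.edges ∧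
      ∀ v ∈ dualEdge s(d.fst, d.snd), v ∉ box 2 (s + 1 - 1) := by
    intro d hd
    rw [hQ₁, Walk.darts_concat, List.concat_eq_append, List.mem_append, List.mem_singleton, Walk.darts_concat,
      List.concat_eq_append, List.mem_append, List.mem_singleton] at hd
    rcases hd with (hd | rfl) | rfl
    · -- a dart of `R`: open, columns `≥ s + 1`
      have hu := hR _ (R.dart_fst_mem_support_of_mem_darts hd)
      have hu' := hR _ (R.dart_snd_mem_support_of_mem_darts hd)
      have hsnd := hRd d hd
      refine ⟨hnotP _ (dualEdge_notMem_edges_of_open P₀ hP₀c (hRo _ ((mem_edges_iff_darts R).2 ⟨d, hd, rfl⟩)))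
        fun v hv ↦ ?_, fun v hv ↦ notMem_box_of_lt_apply 0 ?_⟩
      · have := (mem_dualEdge_bounds d.adj hv).2; omega
      · have hb := (mem_dualEdge_bounds d.adj hv).1
        rcases stepKind_of_adj d.adj with ⟨h0, h1⟩ | ⟨h0, h1⟩ | ⟨h1, h0⟩ | ⟨h1, h0⟩ <;> omega
    · -- the sticking-out edge: open, columns `≥ 2s`
      change dualEdge s(p, p + Pi.single 0 1) ∉ P.edges ∧ ∀ v ∈ dualEdge s(p, p + Pi.single 0 1), v ∉ box 2 (s + 1 - 1)
      have hp := hR p R.end_mem_support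
      refine ⟨hnotP _ (dualEdge_notMem_edges_of_open P₀ hP₀c hpe) fun v hv ↦ ?_, fun v hv ↦ notMem_box_of_lt_apply 0 ?_⟩
      · have := (mem_dualEdge_bounds h₁ hv).2; simp at this; omega
      · have := (mem_dualEdge_bounds h₁ hv).1; simp at this; omega
    · -- the device edge: its dual edge lives in the column `2s + 1`, off the dual collar
      change dualEdge s(p + Pi.single 0 1, p + Pi.single 0 1 + Pi.single 0 1) ∉ P.edges ∧
        ∀ v ∈ dualEdge s(p + Pi.single 0 1, p + Pi.single 0 1 + Pi.single 0 1), v ∉ box 2 (s + 1 - 1)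
      have hp := hR p R.end_mem_support
      have hcol : ∀ v ∈ dualEdge s(p + Pi.single 0 1, p + Pi.single 0 1 + Pi.single 0 1), v 0 = 2 * s + 1 ∧ -1 ≤ v 1 := by
        intro v hv; have := mem_dualEdge_bounds h₂ hv; simp at this; omega
      refine ⟨hnotP _ (notMem_edges_of_notMem_support P₀ (Sym2.out_fst_mem _) fun hmem ↦ ?_)
        fun v hv ↦ (hcol v hv).2, fun v hv ↦ notMem_box_of_lt_apply 0 (by have := (hcol v hv).1; omega)⟩
      have h1 := mem_dualCollar_iff.1 (hP₀s _ hmem)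
      have h2 := (hcol _ (Sym2.out_fst_mem _)).1
      omega
  -- WEST arm: the hole edge in front of `w`, `R'`, the sticking-out edge, shifted by `-(1,1)`
  have h₃ : (zdGraph 2).Adj (w + Pi.single 0 1) w := ((zdGraph_adj_iff _ _).2 ⟨0, Or.inl rfl⟩).symm
  have h₄ : (zdGraph 2).Adj p' (p' - Pi.single 0 1) := (zdGraph_adj_iff _ _).2 ⟨0, Or.inr (by simp)⟩
  set Q₂ := Walk.cons h₃ (R'.concat h₄) with hQ₂
  have hQ₂d : ∀ d ∈ Q₂.darts, dualEdge s(d.fst, d.snd) ∉ P.edges ∧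
      ∀ v ∈ dualEdge s(d.fst, d.snd), v ∉ box 2 (s + 1 - 1) := by
    intro d hd
    rw [hQ₂, Walk.darts_cons, List.mem_cons, Walk.darts_concat, List.concat_eq_append, List.mem_append,
      List.mem_singleton] at hd
    rcases hd with rfl | hd | rfl
    · -- the hole edge: its dual edge has both members in the dual hole, off the dual collar
      change dualEdge s(w + Pi.single 0 1, w) ∉ P.edges ∧ ∀ v ∈ dualEdge s(w + Pi.single 0 1, w), v ∉ box 2 (s + 1 - 1)
      have hw := hR' w R'.start_mem_support
      have hcol : ∀ v ∈ dualEdge s(w + Pi.single 0 1, w), v 0 = -((s : ℤ) + 1) ∧ (-1 ≤ v 1 ∧ v 1 ≤ hq s) := by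
        intro v hv; have := mem_dualEdge_bounds h₃ hv; simp at this; omega
      refine ⟨hnotP _ (notMem_edges_of_notMem_support P₀ (Sym2.out_fst_mem _) fun hmem ↦ ?_)
        fun v hv ↦ (hcol v hv).2.1, fun v hv ↦ notMem_box_of_apply_lt 0 (by have := (hcol v hv).1; omega)⟩
      have h1 := mem_dualCollar_iff.1 (hP₀s _ hmem)
      have h2 := hcol _ (Sym2.out_fst_mem (dualEdge s(w + Pi.single 0 1, w)))
      omega
    · -- a dart of `R'`: open, columns `≤ -(s+1)`
      have hu := hR' _ (R'.dart_fst_mem_support_of_mem_darts hd)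
      have hu' := hR' _ (R'.dart_snd_mem_support_of_mem_darts hd)
      refine ⟨hnotP _ (dualEdge_notMem_edges_of_open P₀ hP₀c (hR'o _ ((mem_edges_iff_darts R').2 ⟨d, hd, rfl⟩)))
        fun v hv ↦ ?_, fun v hv ↦ notMem_box_of_apply_lt 0 ?_⟩
      · have := (mem_dualEdge_bounds d.adj hv).2; omega
      · have := (mem_dualEdge_bounds d.adj hv).1; omega
    · -- the sticking-out edge: open, columns `≤ -(2s+1)`
      change dualEdge s(p', p' - Pi.single 0 1) ∉ P.edges ∧ ∀ v ∈ dualEdge s(p', p' - Pi.single 0 1), v ∉ box 2 (s + 1 - 1)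
      have hp' := hR' p' R'.end_mem_support
      refine ⟨hnotP _ (dualEdge_notMem_edges_of_open P₀ hP₀c hp'e) fun v hv ↦ ?_,
        fun v hv ↦ notMem_box_of_apply_lt 0 ?_⟩
      · have := (mem_dualEdge_bounds h₄ hv).2; simp at this; omega
      · have := (mem_dualEdge_bounds h₄ hv).1; simp at this; omega
  -- transport both arms to the lattice of faces and apply the transposed barrier lemma
  have key : ∀ {c d : Site 2} (Q : (zdGraph 2).Walk c d),
      (∀ dq ∈ Q.darts, dualEdge s(dq.fst, dq.snd) ∉ P.edges ∧ ∀ v ∈ dualEdge s(dq.fst, dq.snd), v ∉ box 2 (s + 1 - 1)) →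
      ∀ dq ∈ (Q.map (zdShiftIso (-1 : Site 2)).toHom).darts, sepEdge dq.fst dq.snd ∉ P.edges ∧
        ∀ v ∈ sepEdge dq.fst dq.snd, v ∉ box 2 (s + 1 - 1) := by
    intro c d Q hQ dq hdq
    rw [Walk.darts_map, List.mem_map] at hdq
    obtain ⟨d₀, hd₀, rfl⟩ := hdq
    change sepEdge (d₀.fst + (-1)) (d₀.snd + (-1)) ∉ P.edges ∧ ∀ v ∈ sepEdge (d₀.fst + (-1)) (d₀.snd + (-1)), v ∉ _
    rw [sepEdge_add_neg_one d₀.adj]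
    exact hQ d₀ hd₀
  have he := hR e R.start_mem_support
  have hw := hR' w R'.start_mem_support
  refine sqAnnulus_arms_false_transpose (m := s + 1) (n := 2 * s + 1) (by omega) (by omega) P hPs
    (by push_cast; exact hf₁) (by rw [abs_le]; push_cast; omega)
    (by simp only [Pi.add_apply, single_one_apply_one]; push_cast; omega)
    (by rw [abs_le]; simp only [Pi.add_apply, single_one_apply_zero, add_zero]; push_cast; omega)
    (Q₁.map (zdShiftIso (-1 : Site 2)).toHom) ⟨?_, ?_, ?_⟩ ?_ (key Q₁ hQ₁d)
    (Q₂.map (zdShiftIso (-1 : Site 2)).toHom) ⟨?_, ?_, ?_⟩ ?_ (key Q₂ hQ₂d)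
  · change -((s + 1 : ℕ) : ℤ) + 1 ≤ (e + (-1) : Site 2) 1; simp only [Pi.add_apply, Pi.neg_apply, one_apply_site]; push_cast; omega
  · change (e + (-1) : Site 2) 1 ≤ ((s + 1 : ℕ) : ℤ) - 2; simp only [Pi.add_apply, Pi.neg_apply, one_apply_site]; push_cast; omega
  · change (e + (-1) : Site 2) 0 = ((s + 1 : ℕ) : ℤ) - 1; simp only [Pi.add_apply, Pi.neg_apply, one_apply_site]; push_cast; omega
  · change ((2 * s + 1 : ℕ) : ℤ) ≤ (p + Pi.single 0 1 + Pi.single 0 1 + (-1) : Site 2) 0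
    have hp := hR p R.end_mem_support
    simp only [Pi.add_apply, Pi.neg_apply, one_apply_site, single_zero_apply_zero]; push_cast; omega
  · change -((s + 1 : ℕ) : ℤ) + 1 ≤ (w + Pi.single 0 1 + (-1) : Site 2) 1
    simp only [Pi.add_apply, Pi.neg_apply, one_apply_site, single_zero_apply_one]; push_cast; omega
  · change (w + Pi.single 0 1 + (-1) : Site 2) 1 ≤ ((s + 1 : ℕ) : ℤ) - 2
    simp only [Pi.add_apply, Pi.neg_apply, one_apply_site, single_zero_apply_one]; push_cast; omega
  · change (w + Pi.single 0 1 + (-1) : Site 2) 0 = -((s + 1 : ℕ) : ℤ)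
    simp only [Pi.add_apply, Pi.neg_apply, one_apply_site, single_zero_apply_zero]; push_cast; omega
  · change (p' - Pi.single 0 1 + (-1) : Site 2) 0 + 1 ≤ -((2 * s + 1 : ℕ) : ℤ)
    have hp' := hR' p' R'.end_mem_support
    simp only [Pi.add_apply, Pi.sub_apply, Pi.neg_apply, one_apply_site, single_zero_apply_zero]; push_cast; omega

end ZStrands

end Summit.CriticalPhenomena.CardyFormulaZ2.Cruxes.NestingRigidity.PinchResampling

end
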